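import Literature.Algebra.EuclideanLattices.ModulusSwitchCore
import Literature.Algebra.EuclideanLattices.ScaledIntLattice
import Literature.Computability.Cryptography.LWENoise
import HarnessLib

/-!
# BLPRS 2013, Lemma 3.5 (`G = I`) in `LWE` vocabulary: the modulus-switching map on `ℤ_qⁿ × 𝕋`

Topic `Computability/Cryptography` (family `pqc`). Layer L1 of the decomposition of the named fact
`Literature.Computability.Cryptography.blprs_gapSVP_sqrt_dim_to_lwe_classical` (**pqc.S21**,
Brakerski–Langlois–Peikert–Regev–Stehlé, STOC 2013): the single-sample map of **Lemma 3.5** for `G = I`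
(the case of Cor. 3.2, modulus reduction `q → q'` in dimension `n`), stated on the tree's model of
`LWE` samples with continuous noise (`LWENoise.lean`: samples in `ℤ_qⁿ × 𝕋`, `𝕋 = ℝ/ℤ`,
`A_{s,φ} = torusLWESample q φ s`, `Ψ_α = wrappedGaussian α = D_α mod 1`), and its two printed properties
PROVED, by instantiating the coordinate-free Lemma 3.5 of
`Literature/Algebra/EuclideanLattices/ModulusSwitchCore.lean` at `M = ℤⁿ ≤ q⁻¹ℤⁿ, q'⁻¹ℤⁿ`
(`ScaledIntLattice.lean`). Everything is a `theorem`; the new `def`s are the map (a Markov kernel) and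
the laws it is applied to; no named fact, no `sorry`.

## The statement (arXiv:1306.0281, pp. 11–12, `G = I`, `n' = n`, `Λ = q'⁻¹ℤⁿ`, `B = I/q'`)

Let `r ≥ max(q⁻¹, q'⁻¹)·√(2 ln(2n(1+1/ε))/π)`. The map `𝕋_qⁿ × 𝕋 → 𝕋_{q'}ⁿ × 𝕋`: on `(a, b)`, choose
`f ← D_{Λ - a, r}`, `v = a + f ∈ Λ/ℤⁿ`, `a' = v`; choose `e' ← D_{rB}`, `b' = b + e'`; output `(a', b')`.
(i) A uniformly random input is mapped to within statistical distance `4ε` of uniform. (ii) An input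
distributed as `A_{q,s,D_α}`, `s ∈ ℤⁿ`, `‖s‖ ≤ B`, is mapped to within `10ε` of `A_{q',s,D_{α'}}`,
`α'² = α² + r²(‖s‖² + B²)`.

## Results

* `modSwitchKernel n q q' r B (a, b)` — THE MAP as a Markov kernel: `x ← discreteGaussian q'⁻¹ℤⁿ r ā`
  (`ā = torusRep a`, i.e. `f = x - ā ← D_{Λ-ā,r}`), `a' = torusClass x` (= `v = ā + f mod ℤⁿ`),
  `e' ← addedNoise r B = D_{rB}`, output `(a', b + e')`; `modSwitchKernel_apply`, Markov
  (`isProbabilityMeasure_modSwitchKernel`), measurable (`measurable_modSwitchKernel`);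
  `modSwitchOutput r B μ = μ.bind K` (the output law on an input law `μ`), `modSwitchOutput_apply`.
* (i): `uniformInput n q = U(ℤ_qⁿ) ⊗ Haar(𝕋)`; `modSwitchOutput_uniformInput_apply`
  (**the output on a uniform input is `fstLaw ⊗ Haar`**: `∑_i Pr[v = i]·vol(S_i)`, by translation
  invariance of Haar measure, `lintegral_addedNoise_preimage`); `abs_modSwitchOutput_uniform_sub_le` —
  **`|Pr_out[S] - U(S)| ≤ 4ε` under the printed hypothesis** — and `statDist_modSwitchOutput_uniform_le`;
  the smoothing-parameter form `abs_modSwitchOutput_uniform_sub_le_of_smoothing`.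
* (ii): `phase`, `coe_phase_eq` (**`⟨a, s mod q⟩.val/q ≡ ⟨ā, s⟩ (mod 1)`**), `coe_inner_eq_coe_inner_rep`
  (`⟨x, s⟩ ≡ ⟨t'(class x), s⟩ (mod 1)`), `coe_phase_add_eq` (the identity
  `b' = ⟨a', s⟩ + e + ⟨-f, s⟩ + e' (mod 1)` of the proof), `liftMap s = Φ : (v, w) ↦ (v, ⟨t' v, s⟩ + w mod 1)`;
  `lintegral_modSwitchKernel_lwe` / `modSwitchOutput_lwe_apply` (closed form of the output law on
  `A_{q,s,D_α}`: the two Gaussians `e, e'` merge into `D_γ`, `gaussianReal_conv_addedNoise`),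
  **`modSwitchOutput_lwe_eq_jointLaw`** (`Pr_out[S] = jointLaw(Φ⁻¹S)`) and
  **`torusLWESample_eq_targetLaw`** (`A_{q',s mod q',Ψ_{α'}}(S) = targetLaw(Φ⁻¹S)`); hence
  `abs_modSwitchOutput_lwe_sub_le` — **`|Pr_out[S] - A_{q',s,D_{α'}}(S)| ≤ 8ε`** (sharper than printed) —
  and the printed `statDist_modSwitchOutput_lwe_le : Δ ≤ 10ε`.
* `smoothing_of_printed`: the printed hypothesis on `r` gives `0 < r`, `η_ε(q⁻¹ℤⁿ) ≤ r/√2`,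
  `η_ε(q'⁻¹ℤⁿ) ≤ r` (Lemma 2.5 for `q⁻¹ℤⁿ`, `ScaledIntLattice.lean`), the hypotheses of the core file.

## Conventions

Samples live in `ℤ_qⁿ × 𝕋` (BLPRS's `𝕋_qⁿ × 𝕋` with `𝕋_q ≅ ℤ_q`); `s ∈ ℤⁿ` enters `torusLWESample`
reduced mod `q` (resp. `q'`) and the norm bound as `‖intVecToEuclidean n s‖ ≤ B`; `D_γ` on `ℝ` is
`gaussianReal 0 (γ²/(2π))` (`ρ_γ(x) = exp(-πx²/γ²)`); Haar measure on `𝕋` is `volume` (a probability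
measure, `UnitAddCircle.measure_univ`). Hypotheses: `0 < n` (paper: `n ≥ 1`),
`0 < ε ≤ 1/2` (paper: `ε ∈ (0, 1/2)`), `0 < α`.

## What is NOT here

Theorem 3.1 / Cor. 3.2 themselves (`m` independent samples, a `(B, δ)`-bounded secret DISTRIBUTION,
unknown noise rate `≤ α`, advantage loss `δ + 14εm`) and Lemma 2.15; the general `G` (Cor. 3.4); the
finite-precision sampling of `D_{Λ-ā,r}` and `D_{rB}` by a machine (§5 / Lemma 2.3).

## References

* Z. Brakerski, A. Langlois, C. Peikert, O. Regev, D. Stehlé, *Classical hardness of learning with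
  errors*, STOC 2013 = arXiv:1306.0281, §2.3, Def. 2.11, Lemma 2.5, Thm. 3.1, Cor. 3.2, **Lemma 3.5 and
  its proof** (pp. 11–12) [BrakerskiEtAl2013].
* O. Regev, *On lattices, learning with errors, random linear codes, and cryptography*, J. ACM 56
  (2009), §2 (`A_{s,φ}`, `Ψ_α`) [Regev2009].
-/

noncomputable section

open MeasureTheory ProbabilityTheory Module Literature.Algebra.EuclideanLattices
  Literature.Algebra.EuclideanLattices.BLPRS2013
open scoped Real ENNReal InnerProductSpace NNReal

namespace Literature.Computability.Cryptography

namespace BLPRS2013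

variable (n q q' : ℕ) [NeZero q] [NeZero q']

/-! ### The coordinate data of Lemma 3.5 for `G = I` -/

/-- `(torusRep, torusClass)` is a system of representatives of `q⁻¹ℤⁿ` modulo `ℤⁿ` (`𝕋_qⁿ ≅ ℤ_qⁿ`), in
the sense of `IsCosetReps`. [cite: BrakerskiEtAl2013, §2.3] -/
theorem isCosetReps_torus :
    IsCosetReps (stdIntLattice n) (invScaledIntLattice n q) (torusRep n q) (torusClass n q) :=
  ⟨stdIntLattice_le_invScaledIntLattice n q, torusRep_mem n q, torusClass_eq_iff n q⟩

/-- The noise `e' ← D_{rB}` added by the reduction: Mathlib's `gaussianReal 0 ((rB)²/(2π))` (the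
normalisation `ρ_s(x) = exp(-πx²/s²)` of `LWENoise.lean`). [cite: BrakerskiEtAl2013, Lemma 3.5 (the map: "Choose `e' ← D_{rB}`")] -/
def addedNoise (r B : ℝ) : Measure ℝ :=
  gaussianReal 0 (Real.toNNReal ((r * B) ^ 2 / (2 * π)))

/-- `D_{rB}` is a probability measure. [folklore] -/
instance isProbabilityMeasure_addedNoise (r B : ℝ) : IsProbabilityMeasure (addedNoise r B) := by
  unfold addedNoise; infer_instance

/-- **The map of Lemma 3.5 for `G = I`, as a Markov kernel on single samples.** On an input
`(a, b) ∈ 𝕋_qⁿ × 𝕋 = ℤ_qⁿ × 𝕋`: choose `f ← D_{Λ - ā, r}` for `Λ = q'⁻¹ℤⁿ` — i.e. `x = ā + f ← D_{Λ, r, ā}`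
(the tree's `discreteGaussian`, centre `ā = torusRep a`) — let `a' = v = ā + f mod ℤⁿ`, the class
`torusClass x ∈ ℤ_{q'}ⁿ` (for `G = I` the equation `Gᵀa' = v` has the unique solution `a' = v`); choose
`e' ← D_{rB}` and output `(a', b + e')`. [cite: BrakerskiEtAl2013, Lemma 3.5 (the map)] -/
def modSwitchKernel (r B : ℝ) (p : (Fin n → ZMod q) × UnitAddCircle) :
    Measure ((Fin n → ZMod q') × UnitAddCircle) :=
  Measure.sum fun x : invScaledIntLattice n q' =>
    discreteGaussian (invScaledIntLattice n q') r (torusRep n q p.1) x •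
      (addedNoise r B).map fun e' : ℝ => (torusClass n q' x, p.2 + (e' : UnitAddCircle))

variable {n q q'}

omit [NeZero q] [NeZero q'] in
/-- Measurability of `e' ↦ (i, b + e' mod 1)`. [folklore] -/
theorem measurable_mk_add_coe (i : Fin n → ZMod q') (b : UnitAddCircle) :
    Measurable fun e' : ℝ => (i, b + (e' : UnitAddCircle)) :=
  measurable_const.prodMk (measurable_const.add LWE.measurable_coe_unitAddCircle)

omit [NeZero q] in
/-- The kernel on a measurable set: `K(a,b)(S) = ∑_{x ∈ Λ} D_{Λ,r,ā}(x) · Pr_{e'}[(class x, b + e') ∈ S]`.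
[folklore] -/
theorem modSwitchKernel_apply (r B : ℝ) (p : (Fin n → ZMod q) × UnitAddCircle)
    {S : Set ((Fin n → ZMod q') × UnitAddCircle)} (hS : MeasurableSet S) :
    modSwitchKernel n q q' r B p S = ∑' x : invScaledIntLattice n q',
      discreteGaussian (invScaledIntLattice n q') r (torusRep n q p.1) x *
        addedNoise r B ((fun e' : ℝ => (torusClass n q' x, p.2 + (e' : UnitAddCircle))) ⁻¹' S) := by
  rw [modSwitchKernel, Measure.sum_apply _ hS]
  refine tsum_congr fun x => ?_
  rw [Measure.smul_apply, smul_eq_mul, Measure.map_apply (measurable_mk_add_coe _ _) hS]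

/-- The kernel is Markov (total mass one). [folklore] -/
instance isProbabilityMeasure_modSwitchKernel (r B : ℝ) (p : (Fin n → ZMod q) × UnitAddCircle) :
    IsProbabilityMeasure (modSwitchKernel n q q' r B p) := by
  constructor
  rw [modSwitchKernel_apply r B p MeasurableSet.univ]
  simp only [Set.preimage_univ, measure_univ, mul_one]
  exact PMF.tsum_coe _

omit [NeZero q] [NeZero q'] in
/-- For a measurable `S`, the set of pairs `(b, e')` with `(i, b + e') ∈ S` is measurable. [folklore] -/
theorem measurableSet_pairs (i : Fin n → ZMod q') {S : Set ((Fin n → ZMod q') × UnitAddCircle)}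
    (hS : MeasurableSet S) :
    MeasurableSet {z : UnitAddCircle × ℝ | (i, z.1 + (z.2 : UnitAddCircle)) ∈ S} :=
  (measurable_const.prodMk (measurable_fst.add (LWE.measurable_coe_unitAddCircle.comp measurable_snd)))
    hS

omit [NeZero q] [NeZero q'] in
/-- Measurability in `b` of `Pr_{e'}[(i, b + e') ∈ S]`. [folklore] -/
theorem measurable_addedNoise_preimage (r B : ℝ) (i : Fin n → ZMod q')
    {S : Set ((Fin n → ZMod q') × UnitAddCircle)} (hS : MeasurableSet S) :
    Measurable fun b : UnitAddCircle =>
      addedNoise r B ((fun e' : ℝ => (i, b + (e' : UnitAddCircle))) ⁻¹' S) :=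
  measurable_measure_prodMk_left (measurableSet_pairs i hS)

/-- **The kernel is measurable** (so that `Measure.bind` computes as an integral; `[NeZero q]` makes
`ℤ_qⁿ` finite, hence countable, for the sectionwise criterion). [folklore] -/
theorem measurable_modSwitchKernel (r B : ℝ) : Measurable (modSwitchKernel n q q' r B) := by
  refine Measure.measurable_of_measurable_coe _ fun S hS => ?_
  have h : (fun p => modSwitchKernel n q q' r B p S) = fun p => ∑' x : invScaledIntLattice n q',
      discreteGaussian (invScaledIntLattice n q') r (torusRep n q p.1) x *
        addedNoise r B ((fun e' : ℝ => (torusClass n q' x, p.2 + (e' : UnitAddCircle))) ⁻¹' S) :=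
    funext fun p => modSwitchKernel_apply r B p hS
  rw [h]
  refine measurable_from_prod_countable_right fun a => ?_
  dsimp only
  refine Measurable.tsum fun x => ?_
  exact (measurable_addedNoise_preimage r B (torusClass n q' x) hS).const_mul _

/-- The output law of the reduction on an input law `μ` of single samples: `μ` then the kernel.
[cite: BrakerskiEtAl2013, Lemma 3.5] -/
def modSwitchOutput (r B : ℝ) (μ : Measure ((Fin n → ZMod q) × UnitAddCircle)) :
    Measure ((Fin n → ZMod q') × UnitAddCircle) :=
  μ.bind (modSwitchKernel n q q' r B)

/-- `(μ K)(S) = ∫ K(p)(S) dμ(p)`. [folklore] -/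
theorem modSwitchOutput_apply (r B : ℝ) (μ : Measure ((Fin n → ZMod q) × UnitAddCircle))
    {S : Set ((Fin n → ZMod q') × UnitAddCircle)} (hS : MeasurableSet S) :
    modSwitchOutput r B μ S = ∫⁻ p, modSwitchKernel n q q' r B p S ∂μ :=
  Measure.bind_apply hS (measurable_modSwitchKernel r B).aemeasurable

/-! ### Lemma 3.5 (i): a uniform input sample is mapped to a `4ε`-uniform sample -/

variable (n q) in
/-- The uniform law on single samples `ℤ_qⁿ × 𝕋` ("the input is uniformly random": the first scenario of
`LWE_{n,q,φ}`, Def. 2.11). [cite: BrakerskiEtAl2013, Def. 2.11 and Lemma 3.5 (first property)] -/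
def uniformInput : Measure ((Fin n → ZMod q) × UnitAddCircle) :=
  (PMF.uniformOfFintype (Fin n → ZMod q)).toMeasure.prod volume

/-- The uniform input law is a probability measure (Haar measure on `𝕋` has total mass one,
`UnitAddCircle.measure_univ`; Mathlib keeps that `IsProbabilityMeasure` instance local). [folklore] -/
instance isProbabilityMeasure_uniformInput : IsProbabilityMeasure (uniformInput n q) := by
  constructor
  rw [uniformInput, ← Set.univ_prod_univ, Measure.prod_prod, measure_univ, UnitAddCircle.measure_univ,
    mul_one]

omit [NeZero q] [NeZero q'] in
/-- `∫ Pr_{e'}[(i, b + e') ∈ S] db = vol(S_i)`: the second coordinate of a uniform sample stays uniform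
after the independent shift `e'` (Haar measure is translation invariant). [cite: BrakerskiEtAl2013, Lemma 3.5 (proof: "both `b` and `e'` are independent of `a'`, and `b ∈ 𝕋` is uniform")] -/
theorem lintegral_addedNoise_preimage (r B : ℝ) (i : Fin n → ZMod q')
    {S : Set ((Fin n → ZMod q') × UnitAddCircle)} (hS : MeasurableSet S) :
    ∫⁻ b, addedNoise r B ((fun e' : ℝ => (i, b + (e' : UnitAddCircle))) ⁻¹' S) ∂volume =
      volume (Prod.mk i ⁻¹' S) := by
  have hP := measurableSet_pairs i hS
  calc ∫⁻ b, addedNoise r B ((fun e' : ℝ => (i, b + (e' : UnitAddCircle))) ⁻¹' S) ∂volume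
      = ((volume : Measure UnitAddCircle).prod (addedNoise r B))
          {z : UnitAddCircle × ℝ | (i, z.1 + (z.2 : UnitAddCircle)) ∈ S} := (Measure.prod_apply hP).symm
    _ = ∫⁻ e', volume ((fun b : UnitAddCircle => (b, e')) ⁻¹'
          {z : UnitAddCircle × ℝ | (i, z.1 + (z.2 : UnitAddCircle)) ∈ S}) ∂(addedNoise r B) :=
        Measure.prod_apply_symm hP
    _ = ∫⁻ _e', volume (Prod.mk i ⁻¹' S) ∂(addedNoise r B) := by
        refine lintegral_congr fun e' => ?_
        have hset : (fun b : UnitAddCircle => (b, e')) ⁻¹'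
            {z : UnitAddCircle × ℝ | (i, z.1 + (z.2 : UnitAddCircle)) ∈ S} =
            (fun b : UnitAddCircle => (e' : UnitAddCircle) + b) ⁻¹' (Prod.mk i ⁻¹' S) := by
          ext b
          simp [add_comm]
        rw [hset, measure_preimage_add]
    _ = volume (Prod.mk i ⁻¹' S) := by rw [lintegral_const, measure_univ, mul_one]

omit [NeZero q] in
/-- `∫ K(a, b)(S) db = ∑_{x ∈ Λ} D_{Λ,r,ā}(x) · vol(S_{class x})`. [folklore] -/
theorem lintegral_modSwitchKernel_uniform (r B : ℝ) (a : Fin n → ZMod q)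
    {S : Set ((Fin n → ZMod q') × UnitAddCircle)} (hS : MeasurableSet S) :
    ∫⁻ b, modSwitchKernel n q q' r B (a, b) S ∂volume = ∑' x : invScaledIntLattice n q',
      discreteGaussian (invScaledIntLattice n q') r (torusRep n q a) x *
        volume (Prod.mk (torusClass n q' x) ⁻¹' S) := by
  simp_rw [modSwitchKernel_apply r B _ hS]
  rw [lintegral_tsum fun x =>
    ((measurable_addedNoise_preimage r B (torusClass n q' x) hS).const_mul _).aemeasurable]
  refine tsum_congr fun x => ?_
  rw [lintegral_const_mul _ (measurable_addedNoise_preimage r B _ hS),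
    lintegral_addedNoise_preimage r B _ hS]

/-- **The output law on a uniform input, in closed form**: `Pr[(a', b') ∈ S] = ∑_i Pr[v = i] · vol(S_i)`
with `Pr[v = i]` the `fstLaw` of `ModulusSwitchCore.lean` — i.e. the output is
`fstLaw ⊗ (uniform on 𝕋)`. [cite: BrakerskiEtAl2013, Lemma 3.5 (proof, first property)] -/
theorem modSwitchOutput_uniformInput_apply (r B : ℝ) {S : Set ((Fin n → ZMod q') × UnitAddCircle)}
    (hS : MeasurableSet S) :
    modSwitchOutput r B (uniformInput n q) S =
      ∑ i, fstLaw (torusRep n q) (torusClass n q') r i * volume (Prod.mk i ⁻¹' S) := by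
  have hmeas : Measurable fun p : (Fin n → ZMod q) × UnitAddCircle => modSwitchKernel n q q' r B p S :=
    (Measure.measurable_coe hS).comp (measurable_modSwitchKernel r B)
  rw [modSwitchOutput_apply r B _ hS, uniformInput, lintegral_prod _ hmeas.aemeasurable,
    lintegral_fintype]
  simp_rw [lintegral_modSwitchKernel_uniform r B _ hS,
    PMF.toMeasure_apply_singleton _ _ (measurableSet_singleton _), PMF.uniformOfFintype_apply,
    fstLaw_apply, coreSum, mul_one]
  -- both sides are `N₁⁻¹ · ∑_{(a,x)} D_{ā}(x) vol(S_{class x})`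
  set N₁ : ℝ≥0∞ := (Fintype.card (Fin n → ZMod q) : ℝ≥0∞) with hN₁
  set D : (Fin n → ZMod q) → invScaledIntLattice n q' → ℝ≥0∞ :=
    fun a x => discreteGaussian (invScaledIntLattice n q') r (torusRep n q a) x with hD
  have hL : ∑ a, (∑' x : invScaledIntLattice n q', D a x * volume (Prod.mk (torusClass n q' x) ⁻¹' S)) * N₁⁻¹
      = N₁⁻¹ * ∑' p : (Fin n → ZMod q) × invScaledIntLattice n q',
          D p.1 p.2 * volume (Prod.mk (torusClass n q' p.2) ⁻¹' S) := by
    rw [← Finset.sum_mul, mul_comm, ENNReal.tsum_prod',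
      tsum_fintype (L := SummationFilter.unconditional _)]
  have hR : ∑ i, N₁⁻¹ * (∑' p : (Fin n → ZMod q) × invScaledIntLattice n q',
        if torusClass n q' p.2 = i then D p.1 p.2 else 0) * volume (Prod.mk i ⁻¹' S)
      = N₁⁻¹ * ∑' p : (Fin n → ZMod q) × invScaledIntLattice n q',
          D p.1 p.2 * volume (Prod.mk (torusClass n q' p.2) ⁻¹' S) := by
    have hstep : ∀ i : Fin n → ZMod q',
        N₁⁻¹ * (∑' p : (Fin n → ZMod q) × invScaledIntLattice n q',
          if torusClass n q' p.2 = i then D p.1 p.2 else 0) * volume (Prod.mk i ⁻¹' S) =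
        N₁⁻¹ * ∑' p : (Fin n → ZMod q) × invScaledIntLattice n q',
          (if torusClass n q' p.2 = i then D p.1 p.2 * volume (Prod.mk i ⁻¹' S) else 0) := by
      intro i
      rw [mul_assoc, ← ENNReal.tsum_mul_right]
      congr 1
      refine tsum_congr fun p => ?_
      split_ifs
      · rfl
      · rw [zero_mul]
    simp_rw [hstep]
    rw [← Finset.mul_sum, ← tsum_fintype (L := SummationFilter.unconditional _)
      (fun i => ∑' p : (Fin n → ZMod q) × invScaledIntLattice n q', _), ENNReal.tsum_comm]
    congr 1
    refine tsum_congr fun p => ?_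
    rw [tsum_fintype (L := SummationFilter.unconditional _), Finset.sum_ite_eq]
    simp
  rw [hL, hR]

omit [NeZero q] in
/-- The uniform law of a set, fibrewise: `U(S) = ∑_i N⁻¹ vol(S_i)`. [folklore] -/
theorem uniformInput_apply {S : Set ((Fin n → ZMod q') × UnitAddCircle)} (hS : MeasurableSet S) :
    uniformInput n q' S =
      ∑ i, (Fintype.card (Fin n → ZMod q') : ℝ≥0∞)⁻¹ * volume (Prod.mk i ⁻¹' S) := by
  rw [uniformInput, measure_eq_sum_singleton_prod _ hS]
  refine Finset.sum_congr rfl fun i _ => ?_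
  rw [Measure.prod_prod, PMF.toMeasure_apply_singleton _ _ (measurableSet_singleton i),
    PMF.uniformOfFintype_apply]

omit [NeZero q] [NeZero q'] in
/-- Weighted differences against `[0,1]`-weights are controlled by the statistical distance:
if `|∑_{i ∈ S} (p_i - u_i)| ≤ δ` for all `S`, then `|∑_i (p_i - u_i) c_i| ≤ δ` whenever `0 ≤ c_i ≤ 1`.
[folklore] -/
theorem abs_sum_sub_mul_le {ι : Type*} [Fintype ι] {p u c : ι → ℝ} {δ : ℝ} (hc0 : ∀ i, 0 ≤ c i)
    (hc1 : ∀ i, c i ≤ 1) (h : ∀ S : Finset ι, |∑ i ∈ S, (p i - u i)| ≤ δ) :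
    |∑ i, (p i - u i) * c i| ≤ δ := by
  classical
  rw [abs_le]
  constructor
  · -- lower bound through the negative part
    set S : Finset ι := Finset.univ.filter fun i => p i - u i < 0 with hSdef
    have hS := (abs_le.1 (h S)).1
    have hle : ∑ i ∈ S, (p i - u i) ≤ ∑ i, (p i - u i) * c i := by
      rw [hSdef, Finset.sum_filter]
      refine Finset.sum_le_sum fun i _ => ?_
      by_cases hi : p i - u i < 0
      · rw [if_pos hi]; nlinarith [hc0 i, hc1 i]
      · rw [if_neg hi]; nlinarith [hc0 i, hc1 i, not_lt.1 hi]
    linarith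
  · set S : Finset ι := Finset.univ.filter fun i => 0 < p i - u i with hSdef
    have hS := (abs_le.1 (h S)).2
    have hle : ∑ i, (p i - u i) * c i ≤ ∑ i ∈ S, (p i - u i) := by
      rw [hSdef, Finset.sum_filter]
      refine Finset.sum_le_sum fun i _ => ?_
      by_cases hi : 0 < p i - u i
      · rw [if_pos hi]; nlinarith [hc0 i, hc1 i]
      · rw [if_neg hi]; nlinarith [hc0 i, hc1 i, not_lt.1 hi]
    linarith

/-- **BLPRS 2013, Lemma 3.5, first property (`G = I`), in `LWE` vocabulary.** Let `0 < ε ≤ 1/2`,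
`0 < r` with `η_ε(q⁻¹ℤⁿ) ≤ r` and `η_ε(q'⁻¹ℤⁿ) ≤ r` (both follow from the printed
`r ≥ max(q⁻¹, q'⁻¹)·√(2 ln(2n(1+1/ε))/π)`, see `abs_modSwitchOutput_uniform_sub_le`). Then the reduction
maps a uniform sample of `ℤ_qⁿ × 𝕋` to within statistical distance `4ε` of a uniform sample of
`ℤ_{q'}ⁿ × 𝕋`: `|Pr_out[S] - U(S)| ≤ 4ε` for every measurable `S`. [cite: BrakerskiEtAl2013, Lemma 3.5 (first property)] -/
theorem abs_modSwitchOutput_uniform_sub_le_of_smoothing {ε r : ℝ} (B : ℝ) (hε : 0 < ε) (hε' : ε ≤ 1 / 2)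
    (hr : 0 < r) (hη₁ : smoothingParameter (invScaledIntLattice n q) ε ≤ r)
    (hη₂ : smoothingParameter (invScaledIntLattice n q') ε ≤ r)
    {S : Set ((Fin n → ZMod q') × UnitAddCircle)} (hS : MeasurableSet S) :
    |(modSwitchOutput r B (uniformInput n q)).real S - (uniformInput n q').real S| ≤ 4 * ε := by
  set P : PMF (Fin n → ZMod q') := fstLaw (torusRep n q) (torusClass n q') r with hP
  have hfin : ∀ i : Fin n → ZMod q', P i * volume (Prod.mk i ⁻¹' S) ≠ ∞ := fun i =>
    ENNReal.mul_ne_top (PMF.apply_ne_top _ _) (measure_ne_top _ _)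
  have hfin' : ∀ i : Fin n → ZMod q',
      (Fintype.card (Fin n → ZMod q') : ℝ≥0∞)⁻¹ * volume (Prod.mk i ⁻¹' S) ≠ ∞ := fun i =>
    ENNReal.mul_ne_top (ENNReal.inv_ne_top.2 (by exact_mod_cast Fintype.card_ne_zero))
      (measure_ne_top _ _)
  rw [measureReal_def, measureReal_def, modSwitchOutput_uniformInput_apply r B hS,
    uniformInput_apply hS, ENNReal.toReal_sum fun i _ => hfin i,
    ENNReal.toReal_sum fun i _ => hfin' i, ← Finset.sum_sub_distrib]
  have hterm : ∀ i : Fin n → ZMod q', (P i * volume (Prod.mk i ⁻¹' S)).toReal -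
      ((Fintype.card (Fin n → ZMod q') : ℝ≥0∞)⁻¹ * volume (Prod.mk i ⁻¹' S)).toReal =
      ((P i).toReal - 1 / Fintype.card (Fin n → ZMod q')) * (volume (Prod.mk i ⁻¹' S)).toReal := by
    intro i
    rw [ENNReal.toReal_mul, ENNReal.toReal_mul, ENNReal.toReal_inv, ENNReal.toReal_natCast,
      one_div, sub_mul]
  simp_rw [hterm]
  refine abs_sum_sub_mul_le (fun i => ENNReal.toReal_nonneg)
    (fun i => ENNReal.toReal_le_of_le_ofReal zero_le_one
      (by rw [ENNReal.ofReal_one, ← UnitAddCircle.measure_univ]; exact measure_mono (Set.subset_univ _)))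
    fun T => ?_
  have h := abs_sum_fstLaw_toReal_sub_le (isCosetReps_torus n q) (isCosetReps_torus n q') hε hε' hr
    hη₁ hη₂ T
  rw [Finset.sum_sub_distrib, Finset.sum_const, nsmul_eq_mul, mul_one_div]
  exact h

/-! ### Lemma 3.5 (ii): an `A_{q,s,D_α}` sample is mapped close to an `A_{q',s,D_{α'}}` sample -/

section LWEInput

variable (s : Fin n → ℤ)

/-- The phase of a sample as the tree writes it, `(⟨a, s mod q⟩).val / q ∈ [0,1)` (`torusSampleMap`).
[folklore] -/
def phase (a : Fin n → ZMod q) : ℝ := ((a ⬝ᵥ fun j => (s j : ZMod q)).val : ℝ) / q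

omit [NeZero q'] [NeZero q] in
/-- The inner product of two integer vectors of `ℝⁿ` is an integer. [folklore] -/
theorem exists_int_cast_eq_inner {u v : EuclideanSpace ℝ (Fin n)} (hu : u ∈ stdIntLattice n)
    (hv : v ∈ stdIntLattice n) : ∃ k : ℤ, (k : ℝ) = ⟪u, v⟫_ℝ := by
  choose ku hku using (mem_stdIntLattice_iff u).1 hu
  choose kv hkv using (mem_stdIntLattice_iff v).1 hv
  refine ⟨∑ j, ku j * kv j, ?_⟩
  rw [PiLp.inner_apply]
  push_cast
  refine Finset.sum_congr rfl fun j _ => ?_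
  rw [← hku j, ← hkv j]
  simp [mul_comm]

omit [NeZero q'] in
/-- **The phase is the inner product with the representative, modulo `1`**:
`(⟨a, s mod q⟩).val / q ≡ ⟨ā, s⟩ (mod ℤ)`, `ā = torusRep a`. [cite: BrakerskiEtAl2013, §2.3 ("the mod-1 inner products between vectors in `𝕋_qⁿ` and `s ∈ ℤⁿ`")] -/
theorem coe_phase_eq (a : Fin n → ZMod q) :
    ((phase s a : ℝ) : UnitAddCircle) =
      ((⟪torusRep n q a, intVecToEuclidean n s⟫_ℝ : ℝ) : UnitAddCircle) := by
  have hq : (q : ℝ) ≠ 0 := by exact_mod_cast NeZero.ne q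
  -- the integer `N = ∑ a_j.val s_j` has the same image in `ℤ_q` as `M = (⟨a, s mod q⟩).val`
  set M : ℕ := (a ⬝ᵥ fun j => (s j : ZMod q)).val with hM
  set N : ℤ := ∑ j, ((a j).val : ℤ) * s j with hN
  have hMN : ((M : ℤ) : ZMod q) = ((N : ℤ) : ZMod q) := by
    rw [hM, hN, Int.cast_natCast, ZMod.natCast_zmod_val, dotProduct]
    push_cast
    refine Finset.sum_congr rfl fun j _ => ?_
    rw [ZMod.natCast_zmod_val]
  obtain ⟨c, hc⟩ := (ZMod.intCast_eq_intCast_iff_dvd_sub _ _ _).1 hMN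
  have hinner : ⟪torusRep n q a, intVecToEuclidean n s⟫_ℝ = (N : ℝ) / q := by
    rw [PiLp.inner_apply, hN]
    push_cast
    rw [Finset.sum_div]
    refine Finset.sum_congr rfl fun j _ => ?_
    rw [torusRep_apply, intVecToEuclidean_apply]
    simp only [RCLike.inner_apply, conj_trivial]
    ring
  rw [hinner, phase, ← hM, ← sub_eq_zero, ← AddCircle.coe_sub, AddCircle.coe_eq_zero_iff]
  refine ⟨-c, ?_⟩
  have hc' : ((N : ℤ) : ℝ) - (M : ℝ) = (q : ℝ) * c := by
    have := congrArg (fun z : ℤ => (z : ℝ)) hc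
    push_cast at this
    linarith
  rw [zsmul_eq_mul, mul_one]
  push_cast
  field_simp
  linarith

omit [NeZero q] in
/-- **Changing the representative of the output class changes the phase by an integer**:
`⟨x, s⟩ ≡ ⟨t'(class x), s⟩ (mod ℤ)` for `x ∈ q'⁻¹ℤⁿ` (as `x - t'(class x) ∈ ℤⁿ` and `s ∈ ℤⁿ`).
[cite: BrakerskiEtAl2013, Lemma 3.5 (proof: "`⟨a', Gs⟩ = ⟨Gᵀa', s⟩ ≈ ⟨a, s⟩ mod 1`")] -/
theorem coe_inner_eq_coe_inner_rep (x : invScaledIntLattice n q') :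
    ((⟪(x : EuclideanSpace ℝ (Fin n)), intVecToEuclidean n s⟫_ℝ : ℝ) : UnitAddCircle) =
      ((⟪torusRep n q' (torusClass n q' x), intVecToEuclidean n s⟫_ℝ : ℝ) : UnitAddCircle) := by
  obtain ⟨k, hk⟩ := exists_int_cast_eq_inner ((isCosetReps_torus n q').sub_rep_mem x)
    (intVecToEuclidean_mem_stdIntLattice n s)
  rw [inner_sub_left] at hk
  rw [← sub_eq_zero, ← AddCircle.coe_sub, AddCircle.coe_eq_zero_iff]
  exact ⟨k, by rw [zsmul_eq_mul, mul_one, hk]⟩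

/-- **The output phase, rewritten** (the identity `b' = ⟨a', s⟩ + e + ⟨-f, s⟩ + e' mod 1` of the
proof): for an input of phase `⟨a, s mod q⟩/q`, a rounding point `x` of class `a'` and a real `u`,
`phase + u ≡ ⟨ā', s⟩ + (⟨s, ā - x⟩ + u) (mod 1)`, `ā' = torusRep a'`. [cite: BrakerskiEtAl2013, Lemma 3.5 (proof, last paragraph)] -/
theorem coe_phase_add_eq (a : Fin n → ZMod q) (x : invScaledIntLattice n q') (u : ℝ) :
    ((phase s a + u : ℝ) : UnitAddCircle) =
      ((⟪torusRep n q' (torusClass n q' x), intVecToEuclidean n s⟫_ℝ +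
        (⟪intVecToEuclidean n s, torusRep n q a - (x : EuclideanSpace ℝ (Fin n))⟫_ℝ + u) : ℝ) :
          UnitAddCircle) := by
  have hsplit : ⟪torusRep n q a, intVecToEuclidean n s⟫_ℝ =
      ⟪(x : EuclideanSpace ℝ (Fin n)), intVecToEuclidean n s⟫_ℝ +
        ⟪intVecToEuclidean n s, torusRep n q a - (x : EuclideanSpace ℝ (Fin n))⟫_ℝ := by
    rw [real_inner_comm (torusRep n q a - (x : EuclideanSpace ℝ (Fin n))) (intVecToEuclidean n s),
      inner_sub_left]
    ring
  rw [AddCircle.coe_add, coe_phase_eq, hsplit, AddCircle.coe_add, coe_inner_eq_coe_inner_rep,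
    AddCircle.coe_add, AddCircle.coe_add]
  abel

/-- The lifted output map `Φ(v, w) = (v, ⟨t' v, s⟩ + w mod 1)` from (class, real noise) to a sample of
`ℤ_{q'}ⁿ × 𝕋`; the output of the reduction on `A_{q,s,D_α}` is `Φ(v, w)` with `(v, w) ← jointLaw` and
`A_{q',s,D_{α'}}` is `Φ(v, w)` with `(v, w) ← targetLaw`. [cite: BrakerskiEtAl2013, Lemma 3.5 (proof)] -/
def liftMap (z : (Fin n → ZMod q') × ℝ) : (Fin n → ZMod q') × UnitAddCircle :=
  (z.1, ((⟪torusRep n q' z.1, intVecToEuclidean n s⟫_ℝ + z.2 : ℝ) : UnitAddCircle))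

omit [NeZero q] in
/-- `Φ` is measurable. [folklore] -/
theorem measurable_liftMap : Measurable (liftMap (q' := q') s) := by
  refine measurable_from_prod_countable_right fun v => ?_
  change Measurable fun w : ℝ =>
    (v, ((⟪torusRep n q' v, intVecToEuclidean n s⟫_ℝ + w : ℝ) : UnitAddCircle))
  exact measurable_const.prodMk (LWE.measurable_coe_unitAddCircle.comp (measurable_const_add _))

omit [NeZero q] [NeZero q'] in
/-- `D_α ∗ D_{rB} = D_γ`, `γ² = α² + (rB)²` (sum of independent centred Gaussians), in the tree's
normalisation. [folklore] -/
theorem gaussianReal_conv_addedNoise (r B α : ℝ) :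
    gaussianReal 0 (Real.toNNReal (α ^ 2 / (2 * π))) ∗ addedNoise r B = noiseLaw r α B := by
  rw [addedNoise, gaussianReal_conv_gaussianReal, add_zero, noiseLaw,
    ← Real.toNNReal_add (by positivity) (by positivity), ← add_div]

/-- **The kernel integrated against the noise of an `LWE` sample**: for fixed `a`,
`∫ K(a, phase + ē)(S) dΨ_α(ē) = ∑_x D_{Λ,r,ā}(x) · Pr_{u ← D_γ}[(class x, phase + u mod 1) ∈ S]`.
[cite: BrakerskiEtAl2013, Lemma 3.5 (proof, last paragraph)] -/
theorem lintegral_modSwitchKernel_lwe (r B α : ℝ) (a : Fin n → ZMod q)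
    {S : Set ((Fin n → ZMod q') × UnitAddCircle)} (hS : MeasurableSet S) :
    ∫⁻ ē, modSwitchKernel n q q' r B (a, ((phase s a : ℝ) : UnitAddCircle) + ē) S
        ∂(LWE.wrappedGaussian α) =
      ∑' x : invScaledIntLattice n q',
        discreteGaussian (invScaledIntLattice n q') r (torusRep n q a) x *
          noiseLaw r α B ((fun u : ℝ => (torusClass n q' x, ((phase s a + u : ℝ) : UnitAddCircle))) ⁻¹' S) := by
  have hK : Measurable fun ē : UnitAddCircle =>
      modSwitchKernel n q q' r B (a, ((phase s a : ℝ) : UnitAddCircle) + ē) S :=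
    ((Measure.measurable_coe hS).comp (measurable_modSwitchKernel r B)).comp
      (measurable_const.prodMk (measurable_const_add _))
  rw [LWE.wrappedGaussian, lintegral_map hK LWE.measurable_coe_unitAddCircle]
  simp_rw [modSwitchKernel_apply r B _ hS]
  have hterm : ∀ x : invScaledIntLattice n q', Measurable fun e : ℝ =>
      addedNoise r B ((fun e' : ℝ => (torusClass n q' x,
        ((phase s a : ℝ) : UnitAddCircle) + (e : UnitAddCircle) + (e' : UnitAddCircle))) ⁻¹' S) :=
    fun x => (measurable_addedNoise_preimage r B (torusClass n q' x) hS).comp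
      (measurable_const.add LWE.measurable_coe_unitAddCircle)
  rw [lintegral_tsum fun x => ((hterm x).const_mul _).aemeasurable]
  refine tsum_congr fun x => ?_
  rw [lintegral_const_mul _ (hterm x)]
  congr 1
  -- `∫ Pr_{e'}[(i, phase + e + e') ∈ S] dD_α(e) = (D_α ⊗ D_{rB})(pairs) = (D_α ∗ D_{rB})(W) = D_γ(W)`
  set i := torusClass n q' x with hi
  set W : Set ℝ := (fun u : ℝ => (i, ((phase s a + u : ℝ) : UnitAddCircle))) ⁻¹' S with hW
  have hWm : MeasurableSet W :=
    (measurable_const.prodMk (LWE.measurable_coe_unitAddCircle.comp (measurable_const_add _))) hS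
  have hpre : ∀ e : ℝ, (fun e' : ℝ => (i, ((phase s a : ℝ) : UnitAddCircle) + (e : UnitAddCircle) +
      (e' : UnitAddCircle))) ⁻¹' S = Prod.mk e ⁻¹' ((fun z : ℝ × ℝ => z.1 + z.2) ⁻¹' W) := by
    intro e
    ext e'
    simp only [hW, Set.mem_preimage, AddCircle.coe_add]
    rw [add_assoc]
  simp_rw [hpre]
  rw [← Measure.prod_apply (measurable_add hWm), ← Measure.map_apply measurable_add hWm]
  change (gaussianReal 0 (Real.toNNReal (α ^ 2 / (2 * π))) ∗ addedNoise r B) W = noiseLaw r α B W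
  rw [gaussianReal_conv_addedNoise]

/-- **The output law on an `LWE` input, in closed form.** [cite: BrakerskiEtAl2013, Lemma 3.5 (proof)] -/
theorem modSwitchOutput_lwe_apply (r B α : ℝ) {S : Set ((Fin n → ZMod q') × UnitAddCircle)}
    (hS : MeasurableSet S) :
    modSwitchOutput r B (LWE.torusLWESample q (LWE.wrappedGaussian α) fun j => (s j : ZMod q)) S =
      ∑ a : Fin n → ZMod q, (Fintype.card (Fin n → ZMod q) : ℝ≥0∞)⁻¹ *
        ∑' x : invScaledIntLattice n q',
          discreteGaussian (invScaledIntLattice n q') r (torusRep n q a) x *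
            noiseLaw r α B ((fun u : ℝ => (torusClass n q' x, ((phase s a + u : ℝ) : UnitAddCircle))) ⁻¹' S) := by
  have hmeas : Measurable fun p : (Fin n → ZMod q) × UnitAddCircle => modSwitchKernel n q q' r B p S :=
    (Measure.measurable_coe hS).comp (measurable_modSwitchKernel r B)
  rw [modSwitchOutput_apply r B _ hS, LWE.torusLWESample,
    lintegral_map hmeas (LWE.measurable_torusSampleMap q _),
    lintegral_prod (fun z : (Fin n → ZMod q) × UnitAddCircle =>
        modSwitchKernel n q q' r B (LWE.torusSampleMap q (fun j => (s j : ZMod q)) z) S)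
      (hmeas.comp (LWE.measurable_torusSampleMap q _)).aemeasurable, lintegral_fintype]
  refine Finset.sum_congr rfl fun a _ => ?_
  rw [PMF.toMeasure_apply_singleton _ _ (measurableSet_singleton _), PMF.uniformOfFintype_apply, mul_comm]
  congr 1
  exact lintegral_modSwitchKernel_lwe s r B α a hS

/-- **The output on `A_{q,s,D_α}` is the lattice-form joint law pushed through `Φ`**:
`Pr_out[S] = jointLaw(Φ⁻¹ S)`. [cite: BrakerskiEtAl2013, Lemma 3.5 (proof)] -/
theorem modSwitchOutput_lwe_eq_jointLaw (r B α : ℝ) {S : Set ((Fin n → ZMod q') × UnitAddCircle)}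
    (hS : MeasurableSet S) :
    modSwitchOutput r B (LWE.torusLWESample q (LWE.wrappedGaussian α) fun j => (s j : ZMod q)) S =
      jointLaw (torusRep n q) (torusClass n q') r α B (intVecToEuclidean n s) (liftMap s ⁻¹' S) := by
  have hA : MeasurableSet (liftMap s ⁻¹' S) := measurable_liftMap s hS
  rw [modSwitchOutput_lwe_apply s r B α hS, jointLaw, Measure.sum_apply _ hA, ENNReal.tsum_prod',
    tsum_fintype (L := SummationFilter.unconditional _)]
  refine Finset.sum_congr rfl fun a _ => ?_
  rw [← ENNReal.tsum_mul_left]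
  refine tsum_congr fun x => ?_
  dsimp only
  rw [Measure.smul_apply, smul_eq_mul,
    Measure.map_apply (measurable_const.prodMk (measurable_const_add _)) hA, mul_assoc]
  have hset : (fun u : ℝ => (torusClass n q' x, ((phase s a + u : ℝ) : UnitAddCircle))) ⁻¹' S =
      (fun e : ℝ => (torusClass n q' x,
        ⟪intVecToEuclidean n s, torusRep n q a - (x : EuclideanSpace ℝ (Fin n))⟫_ℝ + e)) ⁻¹'
          (liftMap s ⁻¹' S) := by
    ext u
    simp only [Set.mem_preimage, liftMap]
    rw [coe_phase_add_eq s a x u]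
  rw [hset]

omit [NeZero q] in
/-- **`A_{q',s,D_{α'}}` is the lattice-form target law pushed through `Φ`**:
`A_{q', s mod q', Ψ_{α'}}(S) = targetLaw(Φ⁻¹ S)`, `α'² = α² + r²(‖s‖² + B²)`. [cite: BrakerskiEtAl2013, Lemma 3.5 (second property)] -/
theorem torusLWESample_eq_targetLaw (r B α : ℝ) {S : Set ((Fin n → ZMod q') × UnitAddCircle)}
    (hS : MeasurableSet S) :
    LWE.torusLWESample q'
        (LWE.wrappedGaussian (Real.sqrt (α ^ 2 + r ^ 2 * (‖intVecToEuclidean n s‖ ^ 2 + B ^ 2))))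
        (fun j => (s j : ZMod q')) S =
      targetLaw (Fin n → ZMod q') r α B (intVecToEuclidean n s) (liftMap s ⁻¹' S) := by
  have hA : MeasurableSet (liftMap s ⁻¹' S) := measurable_liftMap s hS
  have hsq : Real.sqrt (α ^ 2 + r ^ 2 * (‖intVecToEuclidean n s‖ ^ 2 + B ^ 2)) ^ 2 =
      α ^ 2 + r ^ 2 * (‖intVecToEuclidean n s‖ ^ 2 + B ^ 2) := Real.sq_sqrt (by positivity)
  rw [LWE.torusLWESample, Measure.map_apply (LWE.measurable_torusSampleMap q' _) hS,
    measure_eq_sum_singleton_prod _ ((LWE.measurable_torusSampleMap q' _) hS),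
    measure_eq_sum_singleton_prod _ hA]
  refine Finset.sum_congr rfl fun v _ => ?_
  rw [Measure.prod_prod, PMF.toMeasure_apply_singleton _ _ (measurableSet_singleton v),
    PMF.uniformOfFintype_apply, targetLaw_singleton_prod, LWE.wrappedGaussian,
    Measure.map_apply LWE.measurable_coe_unitAddCircle
      (measurable_prodMk_left ((LWE.measurable_torusSampleMap q' _) hS)), hsq]
  congr 2
  ext w
  simp only [Set.mem_preimage, liftMap, LWE.torusSampleMap]
  change (v, ((phase (q := q') s v : ℝ) : UnitAddCircle) + (w : UnitAddCircle)) ∈ S ↔ _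
  rw [coe_phase_eq, ← AddCircle.coe_add]

end LWEInput

/-! ### The printed hypotheses and the two properties as printed -/

omit [NeZero q] [NeZero q'] in
/-- The radical of Lemma 3.5 is positive for `n ≥ 1`. [folklore] -/
theorem sqrt_log_pos {ε : ℝ} (hn : 0 < n) (hε : 0 < ε) :
    0 < Real.sqrt (2 * Real.log (2 * n * (1 + 1 / ε)) / π) := by
  refine Real.sqrt_pos.2 (div_pos (mul_pos two_pos (Real.log_pos ?_)) Real.pi_pos)
  have hn1 : (1 : ℝ) ≤ n := by exact_mod_cast hn
  have : (1 : ℝ) < 1 + 1 / ε := by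
    have := one_div_pos.2 hε
    linarith
  nlinarith

/-- From the printed `r ≥ max(q⁻¹, ‖B̃‖)·√(2 ln(2n(1+1/ε))/π)` (`‖B̃‖ = q'⁻¹` for `B = I/q'`): `0 < r`,
`η_ε(q⁻¹ℤⁿ) ≤ r/√2` and `η_ε(q'⁻¹ℤⁿ) ≤ r/√2 ≤ r` (Lemma 2.5). [cite: BrakerskiEtAl2013, Lemma 3.5 (hypothesis) with Lemma 2.5] -/
theorem smoothing_of_printed {ε r : ℝ} (hn : 0 < n) (hε : 0 < ε)
    (hr : max (q : ℝ)⁻¹ (q' : ℝ)⁻¹ * Real.sqrt (2 * Real.log (2 * n * (1 + 1 / ε)) / π) ≤ r) :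
    0 < r ∧ smoothingParameter (invScaledIntLattice n q) ε ≤ r / Real.sqrt 2 ∧
      smoothingParameter (invScaledIntLattice n q') ε ≤ r / Real.sqrt 2 ∧
      smoothingParameter (invScaledIntLattice n q') ε ≤ r := by
  have hrad := sqrt_log_pos (n := n) hn hε
  have hq : (0 : ℝ) < (q : ℝ)⁻¹ := inv_pos.2 (by exact_mod_cast Nat.pos_of_ne_zero (NeZero.ne q))
  have hr0 : 0 < r := lt_of_lt_of_le (mul_pos (lt_max_of_lt_left hq) hrad) hr
  have h1 : (q : ℝ)⁻¹ * Real.sqrt (2 * Real.log (2 * n * (1 + 1 / ε)) / π) ≤ r :=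
    (mul_le_mul_of_nonneg_right (le_max_left _ _) hrad.le).trans hr
  have h2 : (q' : ℝ)⁻¹ * Real.sqrt (2 * Real.log (2 * n * (1 + 1 / ε)) / π) ≤ r :=
    (mul_le_mul_of_nonneg_right (le_max_right _ _) hrad.le).trans hr
  have hη₂ := smoothingParameter_invScaledIntLattice_le_div_sqrt_two n q' hε h2
  refine ⟨hr0, smoothingParameter_invScaledIntLattice_le_div_sqrt_two n q hε h1, hη₂, hη₂.trans ?_⟩
  refine div_le_self hr0.le ?_
  have := Real.sqrt_le_sqrt (show (1 : ℝ) ≤ 2 by norm_num)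
  rwa [Real.sqrt_one] at this

/-- **BLPRS 2013, Lemma 3.5 (`G = I`), first property, as printed.** Let `n ≥ 1`, `q, q' ≥ 1`,
`ε ∈ (0, 1/2]`, `r ≥ max(q⁻¹, q'⁻¹)·√(2 ln(2n(1+1/ε))/π)` and any `B`. If the input sample is uniform on
`ℤ_qⁿ × 𝕋`, the output of the reduction (`modSwitchKernel`: `f ← D_{q'⁻¹ℤⁿ - ā, r}`, `a' = ā + f mod ℤⁿ`,
`b' = b + e'`, `e' ← D_{rB}`) is within statistical distance `4ε` of uniform on `ℤ_{q'}ⁿ × 𝕋`.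
[cite: BrakerskiEtAl2013, Lemma 3.5 (first property)] -/
theorem abs_modSwitchOutput_uniform_sub_le {ε r : ℝ} (B : ℝ) (hn : 0 < n) (hε : 0 < ε)
    (hε' : ε ≤ 1 / 2)
    (hr : max (q : ℝ)⁻¹ (q' : ℝ)⁻¹ * Real.sqrt (2 * Real.log (2 * n * (1 + 1 / ε)) / π) ≤ r)
    {S : Set ((Fin n → ZMod q') × UnitAddCircle)} (hS : MeasurableSet S) :
    |(modSwitchOutput r B (uniformInput n q)).real S - (uniformInput n q').real S| ≤ 4 * ε := by
  obtain ⟨hr0, hη₁, -, hη₂⟩ := smoothing_of_printed (q := q) (q' := q') hn hε hr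
  refine abs_modSwitchOutput_uniform_sub_le_of_smoothing B hε hε' hr0 (hη₁.trans ?_) hη₂ hS
  refine div_le_self hr0.le ?_
  have := Real.sqrt_le_sqrt (show (1 : ℝ) ≤ 2 by norm_num)
  rwa [Real.sqrt_one] at this

/-- The first property with the tree's `statDist`. [cite: BrakerskiEtAl2013, Lemma 3.5 (first property)] -/
theorem statDist_modSwitchOutput_uniform_le {ε r : ℝ} (B : ℝ) (hn : 0 < n) (hε : 0 < ε)
    (hε' : ε ≤ 1 / 2)
    (hr : max (q : ℝ)⁻¹ (q' : ℝ)⁻¹ * Real.sqrt (2 * Real.log (2 * n * (1 + 1 / ε)) / π) ≤ r) :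
    statDist (modSwitchOutput r B (uniformInput n q)) (uniformInput n q') ≤ 4 * ε :=
  statDist_le_of_forall_abs_sub_le (by positivity) fun _ hS =>
    abs_modSwitchOutput_uniform_sub_le B hn hε hε' hr hS

/-- **BLPRS 2013, Lemma 3.5 (`G = I`), second property, sharpened constant.** Let `n ≥ 1`,
`ε ∈ (0, 1/2]`, `r ≥ max(q⁻¹, q'⁻¹)·√(2 ln(2n(1+1/ε))/π)`, `0 < α`, `s ∈ ℤⁿ` with `‖s‖ ≤ B`. If the input
sample is distributed as `A_{q, s, D_α}` (the tree's `torusLWESample q Ψ_α (s mod q)`), the output of the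
reduction is within `8ε` (printed: `10ε`) of `A_{q', s, D_{α'}}` with `α'² = α² + r²(‖s‖² + B²)`:
`|Pr_out[S] - A_{q',s,D_{α'}}(S)| ≤ 8ε` for every measurable `S`. [cite: BrakerskiEtAl2013, Lemma 3.5 (second property)] -/
theorem abs_modSwitchOutput_lwe_sub_le {ε r α B : ℝ} (hn : 0 < n) (hε : 0 < ε) (hε' : ε ≤ 1 / 2)
    (hr : max (q : ℝ)⁻¹ (q' : ℝ)⁻¹ * Real.sqrt (2 * Real.log (2 * n * (1 + 1 / ε)) / π) ≤ r)
    (hα : 0 < α) (s : Fin n → ℤ) (hsB : ‖intVecToEuclidean n s‖ ≤ B)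
    {S : Set ((Fin n → ZMod q') × UnitAddCircle)} (hS : MeasurableSet S) :
    |(modSwitchOutput r B (LWE.torusLWESample q (LWE.wrappedGaussian α) fun j => (s j : ZMod q))).real S -
      (LWE.torusLWESample q'
        (LWE.wrappedGaussian (Real.sqrt (α ^ 2 + r ^ 2 * (‖intVecToEuclidean n s‖ ^ 2 + B ^ 2))))
        (fun j => (s j : ZMod q'))).real S| ≤ 8 * ε := by
  obtain ⟨hr0, hη₁, -, hη₂⟩ := smoothing_of_printed (q := q) (q' := q') hn hε hr
  rw [measureReal_def, measureReal_def, modSwitchOutput_lwe_eq_jointLaw s r B α hS,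
    torusLWESample_eq_targetLaw s r B α hS, ← measureReal_def, ← measureReal_def]
  exact abs_jointLaw_real_sub_targetLaw_real_le (isCosetReps_torus n q) (isCosetReps_torus n q') hε hε'
    hr0 hα hsB hη₁ hη₂ (measurable_liftMap s hS)

/-- **BLPRS 2013, Lemma 3.5 (`G = I`), second property, as printed**: statistical distance at most
`10ε`. [cite: BrakerskiEtAl2013, Lemma 3.5 (second property)] -/
theorem statDist_modSwitchOutput_lwe_le {ε r α B : ℝ} (hn : 0 < n) (hε : 0 < ε) (hε' : ε ≤ 1 / 2)
    (hr : max (q : ℝ)⁻¹ (q' : ℝ)⁻¹ * Real.sqrt (2 * Real.log (2 * n * (1 + 1 / ε)) / π) ≤ r)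
    (hα : 0 < α) (s : Fin n → ℤ) (hsB : ‖intVecToEuclidean n s‖ ≤ B) :
    statDist (modSwitchOutput r B (LWE.torusLWESample q (LWE.wrappedGaussian α) fun j => (s j : ZMod q)))
      (LWE.torusLWESample q'
        (LWE.wrappedGaussian (Real.sqrt (α ^ 2 + r ^ 2 * (‖intVecToEuclidean n s‖ ^ 2 + B ^ 2))))
        fun j => (s j : ZMod q')) ≤ 10 * ε :=
  statDist_le_of_forall_abs_sub_le (by positivity) fun _ hS =>
    (abs_modSwitchOutput_lwe_sub_le hn hε hε' hr hα s hsB hS).trans (by linarith)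

end BLPRS2013

end Literature.Computability.Cryptography

end
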